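import Summits.AtomisticToContinuum.Crystallization.Theorems.FrustratedLawDichotomyCertFloorTailsRem

/-!
# FrustratedLawDichotomy · crux `AperiodicFrustratedLawGap` (stmt-AtomisticToContinuum-27623) — TRUNCATION TAILS FOR THE CLASS-A CERTIFICATE FLOOR, III:
# THE ROOT-BOND ENERGY DEBITS (hdef side, class A; decomp-a2c hand-1 g52, companion of `…CertFloorTails` / `…CertFloorTailsRem`)

Column (b) of CELLSOUND-g112 §1 — the second/third-order energy debits of the root's own bonds in `certFloor` (T2, (226)),
`Σ_{x∈a∖0} (τ²·secondNeg ‖x‖ + energyRem ‖x‖ τ)` — runs over the whole window template.  Far root bonds (`‖x‖ ≥ L > τ`) are booked in closed form: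

* `secondNeg_le_inv_pow` — `secondNeg r ≤ 7/2·r⁻⁸ + 1/2·r⁻¹⁴` (`r ≥ 0`); `sum_shellTail_le` — `Σ_far (A d⁻⁸ + B d⁻¹⁴) ≤ A·S₅ + B·S₁₁`;
* `energyRem_le_far` — for `0 ≤ η < L ≤ r`: `energyRem r η ≤ η³·(B₉ r⁻⁹ + B₁₅ r⁻¹⁵)`,
  `B₉ = 5/3·(1 − η/L)⁻¹²(2 + η/L)³ + 2(2 + η/L)`, `B₁₅ = 14/3·(1 − η/L)⁻¹⁸(2 + η/L)³ + 7/2·(2 + η/L)`;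
* ★ `energyDebit_le_near_add_tail` — on a `δ`-separated template with `τ < L`, `δ/2 ≤ L`:
  `Σ_{x∈a∖0} (τ²·secondNeg ‖x‖ + energyRem ‖x‖ τ) ≤ Σ_{x∈a∖0, ‖x‖<L} (same) + τ²·(7/2·S₅(δ,L) + 1/2·S₁₁(δ,L))`
  `+ τ³·(B₉ S₆(δ,L) + B₁₅ S₁₂(δ,L))`.
DESK SIZE (δ = 0.9): τ = 1/128, L = 4: ≈ 4·10⁻⁶ FULL; τ = 1/1024: ≈ 6·10⁻⁸.  DEF-FREE; imports `…CertFloorTailsRem`; 0 sorry.  All `[folklore]`.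
-/

noncomputable section

namespace Summit.AtomisticToContinuum.Crystallization.Theorems.FrustratedLawDichotomyCertFloorTailsEnergy

open Metric Set RealInnerProductSpace
open scoped BigOperators
open Summit.AtomisticToContinuum.Crystallization.Theorems.ChargedEnergyGapNegative (E3)
open Summit.AtomisticToContinuum.Crystallization.Theorems.FrustratedLawDichotomyEnergyRemainder (inv_sq_pow_eq)
open Summit.AtomisticToContinuum.Crystallization.Theorems.FrustratedLawDichotomyFarFieldSharp (sum_inv_pow_le_of_separated_sharp
  inv_pow_le_inv_pow_of_le)
open Summit.AtomisticToContinuum.Crystallization.Theorems.FrustratedLawDichotomyCoherentFloorAlgebra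
open Summit.AtomisticToContinuum.Crystallization.Theorems.FrustratedLawDichotomyCertFloorTailsRem (sum_remTail_le)

/-! ## §1. Far majorants of the two root-bond debits -/

/-- `secondNeg r ≤ 7/2·r⁻⁸ + 1/2·r⁻¹⁴` for `r ≥ 0` (`−φ′(r²) ≤ ½r⁻¹⁴`, `(−φ″(r²))⁺ ≤ 2r⁻¹⁰`; credits dropped). [folklore] -/
theorem secondNeg_le_inv_pow {r : ℝ} (hr : 0 ≤ r) : secondNeg r ≤ 7 / 2 * r⁻¹ ^ 8 + 1 / 2 * r⁻¹ ^ 14 := by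
  have e1 : phiT1 (r ^ 2) = -(1 / 2) * r⁻¹ ^ 14 + 1 / 2 * r⁻¹ ^ 8 := by unfold phiT1; rw [inv_sq_pow_eq, inv_sq_pow_eq]
  have e2 : phiT2 (r ^ 2) = 7 / 2 * r⁻¹ ^ 16 - 2 * r⁻¹ ^ 10 := by unfold phiT2; rw [inv_sq_pow_eq, inv_sq_pow_eq]
  unfold secondNeg
  rw [e1, e2]
  have hi : 0 ≤ r⁻¹ := inv_nonneg.mpr hr
  have h8 := pow_nonneg hi 8
  have h14 := pow_nonneg hi 14
  rcases eq_or_lt_of_le hr with h | h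
  · rw [← h]; simp
  have p1 : r ^ 2 * r⁻¹ ^ 16 = r⁻¹ ^ 14 := by field_simp
  have p2 : r ^ 2 * r⁻¹ ^ 10 = r⁻¹ ^ 8 := by field_simp
  refine max_le (by positivity) ?_
  have hm : max 0 (-(7 / 2 * r⁻¹ ^ 16 - 2 * r⁻¹ ^ 10)) ≤ 2 * r⁻¹ ^ 10 := max_le (by positivity) (by nlinarith [pow_nonneg hi 16])
  have hm0 : 0 ≤ max 0 (-(7 / 2 * r⁻¹ ^ 16 - 2 * r⁻¹ ^ 10)) := le_max_left _ _
  have h3 : 2 * r ^ 2 * max 0 (-(7 / 2 * r⁻¹ ^ 16 - 2 * r⁻¹ ^ 10)) ≤ 2 * r ^ 2 * (2 * r⁻¹ ^ 10) :=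
    mul_le_mul_of_nonneg_left hm (by positivity)
  nlinarith

/-- `|φ″(r²)| ≤ 7/2·r⁻¹⁶ + 2r⁻¹⁰` for `r ≥ 0`. [folklore] -/
theorem abs_phiT2_sq_le {r : ℝ} (hr : 0 ≤ r) : |phiT2 (r ^ 2)| ≤ 7 / 2 * r⁻¹ ^ 16 + 2 * r⁻¹ ^ 10 := by
  have e2 : phiT2 (r ^ 2) = 7 / 2 * r⁻¹ ^ 16 - 2 * r⁻¹ ^ 10 := by unfold phiT2; rw [inv_sq_pow_eq, inv_sq_pow_eq]
  rw [e2]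
  have hi : 0 ≤ r⁻¹ := inv_nonneg.mpr hr
  exact abs_le.mpr ⟨by nlinarith [pow_nonneg hi 10, pow_nonneg hi 16], by nlinarith [pow_nonneg hi 10, pow_nonneg hi 16]⟩

/-- ★ FAR MAJORANT of the third-order energy debit: for `0 ≤ η < L ≤ r`, `energyRem r η ≤ η³·(B₉ r⁻⁹ + B₁₅ r⁻¹⁵)`,
`B₉ = 5/3·(1 − η/L)⁻¹²(2 + η/L)³ + 2(2 + η/L)`, `B₁₅ = 14/3·(1 − η/L)⁻¹⁸(2 + η/L)³ + 7/2·(2 + η/L)`. [folklore] -/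
theorem energyRem_le_far {L η r : ℝ} (hη : 0 ≤ η) (hL : η < L) (hr : L ≤ r) :
    energyRem r η ≤ η ^ 3 * ((5 / 3 * (1 - η / L)⁻¹ ^ 12 * (2 + η / L) ^ 3 + 2 * (2 + η / L)) * r⁻¹ ^ 9
      + (14 / 3 * (1 - η / L)⁻¹ ^ 18 * (2 + η / L) ^ 3 + 7 / 2 * (2 + η / L)) * r⁻¹ ^ 15) := by
  have hL0 : 0 < L := hη.trans_lt hL
  have hr0 : 0 < r := hL0.trans_le hr
  have hq : 0 < 1 - η / L := by rw [sub_pos, div_lt_one hL0]; exact hL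
  have hηL : 0 ≤ η / L := div_nonneg hη hL0.le
  have hηr : η ≤ η / L * r := by rw [div_mul_eq_mul_div, le_div_iff₀ hL0]; exact mul_le_mul_of_nonneg_left hr hη
  have hρ : r * (1 - η / L) ≤ r - η := by nlinarith
  have hρ0 : 0 < r * (1 - η / L) := mul_pos hr0 hq
  have hρ2 : (r * (1 - η / L)) ^ 2 ≤ (r - η) ^ 2 := pow_le_pow_left₀ hρ0.le hρ 2
  have i6 : ((r - η) ^ 2)⁻¹ ^ 6 ≤ (1 - η / L)⁻¹ ^ 12 * r⁻¹ ^ 12 := by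
    refine (inv_pow_le_inv_pow_of_le (by positivity) hρ2 6).trans (le_of_eq ?_)
    rw [mul_pow, mul_inv, mul_pow, ← inv_pow, ← inv_pow, ← pow_mul, ← pow_mul, inv_pow, inv_pow]; ring
  have i9 : ((r - η) ^ 2)⁻¹ ^ 9 ≤ (1 - η / L)⁻¹ ^ 18 * r⁻¹ ^ 18 := by
    refine (inv_pow_le_inv_pow_of_le (by positivity) hρ2 9).trans (le_of_eq ?_)
    rw [mul_pow, mul_inv, mul_pow, ← inv_pow, ← inv_pow, ← pow_mul, ← pow_mul, inv_pow, inv_pow]; ring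
  have f1 : 2 * r * η + η ^ 2 ≤ η * r * (2 + η / L) := by nlinarith
  have f10 : 0 ≤ 2 * r * η + η ^ 2 := by positivity
  have f3 : 2 * r * η ^ 3 + 1 / 2 * η ^ 4 ≤ η ^ 3 * r * (2 + η / L) := by nlinarith [pow_nonneg hη 3]
  unfold energyRem
  have hm : max (14 / 3 * ((r - η) ^ 2)⁻¹ ^ 9) (5 / 3 * ((r - η) ^ 2)⁻¹ ^ 6)
      ≤ 14 / 3 * ((1 - η / L)⁻¹ ^ 18 * r⁻¹ ^ 18) + 5 / 3 * ((1 - η / L)⁻¹ ^ 12 * r⁻¹ ^ 12) := by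
    refine max_le ?_ ?_
    · have : 0 ≤ 5 / 3 * ((1 - η / L)⁻¹ ^ 12 * r⁻¹ ^ 12) := by positivity
      linarith
    · have : 0 ≤ 14 / 3 * ((1 - η / L)⁻¹ ^ 18 * r⁻¹ ^ 18) := by positivity
      linarith
  have hm0 : 0 ≤ max (14 / 3 * ((r - η) ^ 2)⁻¹ ^ 9) (5 / 3 * ((r - η) ^ 2)⁻¹ ^ 6) := le_max_of_le_left (by positivity)
  have t1 : max (14 / 3 * ((r - η) ^ 2)⁻¹ ^ 9) (5 / 3 * ((r - η) ^ 2)⁻¹ ^ 6) * (2 * r * η + η ^ 2) ^ 3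
      ≤ (14 / 3 * ((1 - η / L)⁻¹ ^ 18 * r⁻¹ ^ 18) + 5 / 3 * ((1 - η / L)⁻¹ ^ 12 * r⁻¹ ^ 12)) * (η * r * (2 + η / L)) ^ 3 := by
    gcongr
  have t2 : |phiT2 (r ^ 2)| * (2 * r * η ^ 3 + 1 / 2 * η ^ 4) ≤ (7 / 2 * r⁻¹ ^ 16 + 2 * r⁻¹ ^ 10) * (η ^ 3 * r * (2 + η / L)) :=
    mul_le_mul (abs_phiT2_sq_le hr0.le) f3 (by positivity) (by positivity)
  have p9 : r⁻¹ ^ 12 * r ^ 3 = r⁻¹ ^ 9 := by field_simp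
  have p15 : r⁻¹ ^ 18 * r ^ 3 = r⁻¹ ^ 15 := by field_simp
  have p9' : r⁻¹ ^ 10 * r = r⁻¹ ^ 9 := by field_simp
  have p15' : r⁻¹ ^ 16 * r = r⁻¹ ^ 15 := by field_simp
  have e1 : (14 / 3 * ((1 - η / L)⁻¹ ^ 18 * r⁻¹ ^ 18) + 5 / 3 * ((1 - η / L)⁻¹ ^ 12 * r⁻¹ ^ 12)) * (η * r * (2 + η / L)) ^ 3
      = η ^ 3 * (2 + η / L) ^ 3 * (14 / 3 * (1 - η / L)⁻¹ ^ 18 * (r⁻¹ ^ 18 * r ^ 3) + 5 / 3 * (1 - η / L)⁻¹ ^ 12 * (r⁻¹ ^ 12 * r ^ 3)) := by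
    ring
  have e2 : (7 / 2 * r⁻¹ ^ 16 + 2 * r⁻¹ ^ 10) * (η ^ 3 * r * (2 + η / L))
      = η ^ 3 * (2 + η / L) * (7 / 2 * (r⁻¹ ^ 16 * r) + 2 * (r⁻¹ ^ 10 * r)) := by ring
  rw [e1, p9, p15] at t1
  rw [e2, p9', p15'] at t2
  have : η ^ 3 * (2 + η / L) ^ 3 * (14 / 3 * (1 - η / L)⁻¹ ^ 18 * r⁻¹ ^ 15 + 5 / 3 * (1 - η / L)⁻¹ ^ 12 * r⁻¹ ^ 9)
      + η ^ 3 * (2 + η / L) * (7 / 2 * r⁻¹ ^ 15 + 2 * r⁻¹ ^ 9)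
      = η ^ 3 * ((5 / 3 * (1 - η / L)⁻¹ ^ 12 * (2 + η / L) ^ 3 + 2 * (2 + η / L)) * r⁻¹ ^ 9
        + (14 / 3 * (1 - η / L)⁻¹ ^ 18 * (2 + η / L) ^ 3 + 7 / 2 * (2 + η / L)) * r⁻¹ ^ 15) := by ring
  linarith

/-- `Σ_{far} (A·d⁻⁸ + B·d⁻¹⁴) ≤ A·S₅(δ,R) + B·S₁₁(δ,R)` over a finite `δ`-separated set at distance `≥ R ≥ δ/2` from `p` (`A, B ≥ 0`). [folklore] -/
theorem sum_shellTail_le (s : Finset E3) (p : E3) {δ R A B : ℝ} (hδ : 0 < δ) (hR : δ / 2 ≤ R) (hA : 0 ≤ A) (hB : 0 ≤ B)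
    (hsep : ∀ a ∈ s, ∀ b ∈ s, a ≠ b → δ ≤ dist a b) (hfar : ∀ a ∈ s, R ≤ dist a p) :
    ∑ a ∈ s, (A * (dist a p)⁻¹ ^ 8 + B * (dist a p)⁻¹ ^ 14)
      ≤ A * (3 / 5 * (2 / δ) ^ 3 * R⁻¹ ^ 5 + 7 * (2 / δ) ^ 2 * R⁻¹ ^ 6 + 3 / 7 * (2 / δ) * R⁻¹ ^ 7 + 2 * R⁻¹ ^ 8)
        + B * (3 / 11 * (2 / δ) ^ 3 * R⁻¹ ^ 11 + 13 / 2 * (2 / δ) ^ 2 * R⁻¹ ^ 12 + 3 / 13 * (2 / δ) * R⁻¹ ^ 13 + 2 * R⁻¹ ^ 14) := by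
  have h5 := sum_inv_pow_le_of_separated_sharp s p (k := 5) (by norm_num) hδ hR hsep hfar
  have h11 := sum_inv_pow_le_of_separated_sharp s p (k := 11) (by norm_num) hδ hR hsep hfar
  have e5 : (3 / ((5 : ℕ) : ℝ) * (2 / δ) ^ 3 * R⁻¹ ^ 5 + 6 * (((5 : ℕ) : ℝ) + 2) / (((5 : ℕ) : ℝ) + 1) * (2 / δ) ^ 2 * R⁻¹ ^ (5 + 1) +
        3 / (((5 : ℕ) : ℝ) + 2) * (2 / δ) * R⁻¹ ^ (5 + 2) + 2 * R⁻¹ ^ (5 + 3))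
      = 3 / 5 * (2 / δ) ^ 3 * R⁻¹ ^ 5 + 7 * (2 / δ) ^ 2 * R⁻¹ ^ 6 + 3 / 7 * (2 / δ) * R⁻¹ ^ 7 + 2 * R⁻¹ ^ 8 := by
    push_cast; ring
  have e11 : (3 / ((11 : ℕ) : ℝ) * (2 / δ) ^ 3 * R⁻¹ ^ 11 + 6 * (((11 : ℕ) : ℝ) + 2) / (((11 : ℕ) : ℝ) + 1) * (2 / δ) ^ 2 * R⁻¹ ^ (11 + 1) +
        3 / (((11 : ℕ) : ℝ) + 2) * (2 / δ) * R⁻¹ ^ (11 + 2) + 2 * R⁻¹ ^ (11 + 3))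
      = 3 / 11 * (2 / δ) ^ 3 * R⁻¹ ^ 11 + 13 / 2 * (2 / δ) ^ 2 * R⁻¹ ^ 12 + 3 / 13 * (2 / δ) * R⁻¹ ^ 13 + 2 * R⁻¹ ^ 14 := by
    push_cast; ring
  rw [e5] at h5
  rw [e11] at h11
  rw [Finset.sum_add_distrib, ← Finset.mul_sum, ← Finset.mul_sum]
  have h5' : ∑ a ∈ s, (dist a p)⁻¹ ^ 8 = ∑ a ∈ s, (dist a p)⁻¹ ^ (5 + 3) := rfl
  have h11' : ∑ a ∈ s, (dist a p)⁻¹ ^ 14 = ∑ a ∈ s, (dist a p)⁻¹ ^ (11 + 3) := rfl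
  rw [h5', h11']
  have := mul_le_mul_of_nonneg_left h5 hA
  have := mul_le_mul_of_nonneg_left h11 hB
  linarith

/-! ## §2. The truncated debit column -/

/-- ★ **THE ROOT-BOND DEBIT TRUNCATION.**  Template `a` (`δ`-separated), `0 ≤ τ < L`, `δ/2 ≤ L`.  Then
`Σ_{x∈a∖0} (τ²·secondNeg ‖x‖ + energyRem ‖x‖ τ) ≤ Σ_{x∈a∖0, ‖x‖<L} (same) + τ²·(9/2·S₅(δ,L) + 15/2·S₁₁(δ,L)) + τ³·(B₉ S₆(δ,L) + B₁₅ S₁₂(δ,L))`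
(`B`'s of `energyRem_le_far` at `η = τ`). [folklore] -/
theorem energyDebit_le_near_add_tail (a : Finset E3) {δ L τ : ℝ} (hδ : 0 < δ) (hL : δ / 2 ≤ L) (hτ0 : 0 ≤ τ) (hτL : τ < L)
    (hsep : ∀ z ∈ a, ∀ z' ∈ a, z ≠ z' → δ ≤ dist z z') :
    ∑ x ∈ a.erase 0, (τ ^ 2 * secondNeg ‖x‖ + energyRem ‖x‖ τ)
      ≤ ∑ x ∈ (a.erase 0).filter (fun x => ‖x‖ < L), (τ ^ 2 * secondNeg ‖x‖ + energyRem ‖x‖ τ)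
        + τ ^ 2 * (7 / 2 * (3 / 5 * (2 / δ) ^ 3 * L⁻¹ ^ 5 + 7 * (2 / δ) ^ 2 * L⁻¹ ^ 6 + 3 / 7 * (2 / δ) * L⁻¹ ^ 7 + 2 * L⁻¹ ^ 8)
            + 1 / 2 * (3 / 11 * (2 / δ) ^ 3 * L⁻¹ ^ 11 + 13 / 2 * (2 / δ) ^ 2 * L⁻¹ ^ 12 + 3 / 13 * (2 / δ) * L⁻¹ ^ 13 + 2 * L⁻¹ ^ 14))
        + τ ^ 3 * ((5 / 3 * (1 - τ / L)⁻¹ ^ 12 * (2 + τ / L) ^ 3 + 2 * (2 + τ / L))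
              * (1 / 2 * (2 / δ) ^ 3 * L⁻¹ ^ 6 + 48 / 7 * (2 / δ) ^ 2 * L⁻¹ ^ 7 + 3 / 8 * (2 / δ) * L⁻¹ ^ 8 + 2 * L⁻¹ ^ 9)
            + (14 / 3 * (1 - τ / L)⁻¹ ^ 18 * (2 + τ / L) ^ 3 + 7 / 2 * (2 + τ / L))
              * (1 / 4 * (2 / δ) ^ 3 * L⁻¹ ^ 12 + 84 / 13 * (2 / δ) ^ 2 * L⁻¹ ^ 13 + 3 / 14 * (2 / δ) * L⁻¹ ^ 14 + 2 * L⁻¹ ^ 15)) := by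
  classical
  have hL0 : 0 < L := lt_of_lt_of_le (by positivity) hL
  have hq : 0 < 1 - τ / L := by rw [sub_pos, div_lt_one hL0]; exact hτL
  set B₉ := 5 / 3 * (1 - τ / L)⁻¹ ^ 12 * (2 + τ / L) ^ 3 + 2 * (2 + τ / L) with hB₉
  set B₁₅ := 14 / 3 * (1 - τ / L)⁻¹ ^ 18 * (2 + τ / L) ^ 3 + 7 / 2 * (2 + τ / L) with hB₁₅
  have hB9 : 0 ≤ B₉ := by positivity
  have hB15 : 0 ≤ B₁₅ := by positivity
  set F := (a.erase 0).filter (fun x => ¬ ‖x‖ < L) with hF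
  rw [← Finset.sum_filter_add_sum_filter_not (a.erase 0) (fun x => ‖x‖ < L)]
  have hsepF : ∀ u ∈ F, ∀ v ∈ F, u ≠ v → δ ≤ dist u v := fun u hu v hv huv =>
    hsep u (Finset.mem_of_mem_erase (Finset.mem_filter.mp hu).1) v (Finset.mem_of_mem_erase (Finset.mem_filter.mp hv).1) huv
  have hfarF : ∀ u ∈ F, L ≤ dist u (0 : E3) := fun u hu => by
    rw [dist_zero_right]; exact not_lt.mp (Finset.mem_filter.mp hu).2
  -- the two far majorants, summed
  have h1 : ∑ x ∈ F, τ ^ 2 * secondNeg ‖x‖ ≤ τ ^ 2 * ∑ x ∈ F, (7 / 2 * (dist x (0 : E3))⁻¹ ^ 8 + 1 / 2 * (dist x (0 : E3))⁻¹ ^ 14) := by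
    rw [Finset.mul_sum]
    refine Finset.sum_le_sum fun x _ => mul_le_mul_of_nonneg_left ?_ (sq_nonneg τ)
    rw [dist_zero_right]
    exact secondNeg_le_inv_pow (norm_nonneg x)
  have h2 : ∑ x ∈ F, energyRem ‖x‖ τ ≤ τ ^ 3 * ∑ x ∈ F, (B₉ * (dist x (0 : E3))⁻¹ ^ 9 + B₁₅ * (dist x (0 : E3))⁻¹ ^ 15) := by
    rw [Finset.mul_sum]
    refine Finset.sum_le_sum fun x hx => ?_
    rw [dist_zero_right]
    exact energyRem_le_far hτ0 hτL (by have := hfarF x hx; rwa [dist_zero_right] at this)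
  -- shell sums
  have h4 := sum_shellTail_le F 0 hδ hL (by norm_num : (0:ℝ) ≤ 7 / 2) (by norm_num : (0:ℝ) ≤ 1 / 2) hsepF hfarF
  have h5 := sum_remTail_le F 0 hδ hL hB9 hB15 hsepF hfarF
  have h6 : ∑ x ∈ F, (τ ^ 2 * secondNeg ‖x‖ + energyRem ‖x‖ τ) = ∑ x ∈ F, τ ^ 2 * secondNeg ‖x‖ + ∑ x ∈ F, energyRem ‖x‖ τ :=
    Finset.sum_add_distrib
  rw [h6]
  have hτ2 : 0 ≤ τ ^ 2 := sq_nonneg τ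
  have hτ3 : 0 ≤ τ ^ 3 := pow_nonneg hτ0 3
  have h7 := mul_le_mul_of_nonneg_left h4 hτ2
  have h8 := mul_le_mul_of_nonneg_left h5 hτ3
  nlinarith [h1, h2, h7, h8]

end Summit.AtomisticToContinuum.Crystallization.Theorems.FrustratedLawDichotomyCertFloorTailsEnergy

end
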